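import Summits.KontsevichZagierPeriods.KontsevichZagierPeriods.Theorems.RootDecompRationalCubeDichotomyRankDescentP01

/-! # `RootDecompRationalCubeDichotomyRankDescentP02` — part 2/14 of the mechanical ≤400-line split of `RankDescent_v12_landing.lean` (sha256 00885b8b9882f02e…)
Source: decomp-kz lens-2 g13 `RankDescent_v12.lean` (HOME/decomp-kz-lens-2/g13/, sha256 00885b8b…; critic g5-18…g5-66 CLEARED as NODE v1–v12 for crux stmt-KontsevichZagierPeriods-26322 RationalCubePiKernelSingle: rank dichotomy single_of_fullRankGeTwo + RankLeOneKernel, de Rham-exact descent, linear-in-one-variable / hyperbola / Fermat–hyperbolic / conic classes, transport kit, Brieskorn module; writer g7 l.1222: «landing split §0–4 ∣ … ∣ §16 --supports 26322 endorsed»); `#print axioms` pins removed; landed by census-1 g9.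
Split by census-1 g9 `gen/splitlean.py`: scopes re-opened with their `open`/`variable`/`set_option` context; mathematics and declaration order unchanged. -/

noncomputable section
open MeasureTheory Set MvPolynomial
open Literature.NumberTheory.Transcendental
open Literature.NumberTheory.Transcendental.KZ
namespace Summit.KontsevichZagierPeriods.RootDecompRationalCubeDichotomy.Rung26322.RankDescent
variable {M : ℕ}

/-- Auxiliary step `offDeg_shift`: off Deg shift. [bookkeeping] -/
theorem offDeg_shift {j k : Fin M} (hkj : k ≠ j) {e : Fin M →₀ ℕ} (hk : e k ≠ 0) :
    offDeg j (shiftExp e j k) + 1 = offDeg j e := by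
  unfold offDeg
  have hk' : k ∈ Finset.univ.erase j := Finset.mem_erase.2 ⟨hkj, Finset.mem_univ k⟩
  rw [← Finset.add_sum_erase _ _ hk', ← Finset.add_sum_erase _ _ hk']
  have h1 : shiftExp e j k k + 1 = e k := by
    rw [shiftExp_apply, Finsupp.single_eq_same, Finsupp.single_eq_of_ne hkj]
    omega
  have h2 : ∀ i ∈ (Finset.univ.erase j).erase k, shiftExp e j k i = e i := by
    intro i hi
    have hik : i ≠ k := (Finset.mem_erase.1 hi).1
    have hij : i ≠ j := (Finset.mem_erase.1 (Finset.mem_erase.1 hi).2).1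
    rw [shiftExp_apply, Finsupp.single_eq_of_ne hij, Finsupp.single_eq_of_ne hik]
    omega
  rw [Finset.sum_congr rfl h2, ← h1]
  ring

/-- `D_v` of the trial primitive `x^{e+1_j} / (v_j (e_j + 1))`: the monomial `x^e` plus error
monomials `x^{e + 1_j - 1_k}` weighted by `e_k`. [folklore] -/
theorem dirD_trial (v : Fin M → ℚ) (j : Fin M) (hj : v j ≠ 0) (e : Fin M →₀ ℕ) :
    dirD v (monomial (e + Finsupp.single j 1) (1 / (v j * (e j + 1)))) =
      monomial e 1 + ∑ k ∈ Finset.univ.erase j,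
        monomial (shiftExp e j k) (v k * ((1 / (v j * (e j + 1))) * e k)) := by
  rw [dirD_monomial, ← Finset.add_sum_erase _ _ (Finset.mem_univ j)]
  congr 1
  · have hs : e + Finsupp.single j 1 - Finsupp.single j 1 = e := shiftExp_self e j
    rw [hs]
    congr 1
    rw [Finsupp.add_apply, Finsupp.single_eq_same, Nat.cast_add, Nat.cast_one]
    field_simp
  · refine Finset.sum_congr rfl fun k hk => ?_
    have hkj : k ≠ j := (Finset.mem_erase.1 hk).1
    rw [Finsupp.add_apply, Finsupp.single_eq_of_ne hkj, add_zero]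
    rfl

/-- **Solving `D_v G = x^e`** when `v_j ≠ 0`, by induction on the off-`j` degree: the primitive
`x^{e+1_j}/(v_j (e_j+1))` leaves error monomials of smaller off-`j` degree. [folklore] -/
theorem exists_dirD_eq_monomial (v : Fin M → ℚ) (j : Fin M) (hj : v j ≠ 0) :
    ∀ (n : ℕ) (e : Fin M →₀ ℕ), offDeg j e = n → ∃ G, dirD v G = monomial e 1 := by
  intro n
  induction n with
  | zero =>
    intro e he
    refine ⟨monomial (e + Finsupp.single j 1) (1 / (v j * (e j + 1))), ?_⟩
    rw [dirD_trial v j hj e, add_eq_left]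
    refine Finset.sum_eq_zero fun k hk => ?_
    have hk0 : e k = 0 := Finset.sum_eq_zero_iff.1 he k hk
    simp only [hk0, Nat.cast_zero, mul_zero, monomial_zero]
  | succ n ih =>
    intro e he
    have herr : ∀ k : Fin M, ∃ Gk : MvPolynomial (Fin M) ℚ, k ≠ j → e k ≠ 0 →
        dirD v Gk = monomial (shiftExp e j k) 1 := by
      intro k
      by_cases hkj : k = j
      · exact ⟨0, fun h => absurd hkj h⟩
      by_cases hk : e k = 0
      · exact ⟨0, fun _ h => absurd hk h⟩
      have hdeg : offDeg j (shiftExp e j k) = n := by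
        have := offDeg_shift hkj hk; omega
      obtain ⟨G, hG⟩ := ih _ hdeg
      exact ⟨G, fun _ _ => hG⟩
    choose Gk hGk using herr
    refine ⟨monomial (e + Finsupp.single j 1) (1 / (v j * (e j + 1))) -
      ∑ k ∈ Finset.univ.erase j, (v k * ((1 / (v j * (e j + 1))) * e k)) • Gk k, ?_⟩
    rw [map_sub, map_sum, dirD_trial v j hj e, add_sub_assoc, add_eq_left, sub_eq_zero]
    refine Finset.sum_congr rfl fun k hk => ?_
    have hkj : k ≠ j := (Finset.mem_erase.1 hk).1
    rw [map_smul]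
    by_cases hek : e k = 0
    · simp only [hek, Nat.cast_zero, mul_zero, monomial_zero, zero_smul]
    · rw [hGk k hkj hek, smul_monomial, smul_eq_mul, mul_one]

/-- **Every polynomial has a `D_v`-primitive** (`v ≠ 0`). [folklore] -/
theorem exists_dirD_eq (v : Fin M → ℚ) (hv : v ≠ 0) (P : MvPolynomial (Fin M) ℚ) :
    ∃ G, dirD v G = P := by
  obtain ⟨j, hj⟩ : ∃ j, v j ≠ 0 := by
    by_contra h
    exact hv (funext fun j => by simpa using (not_exists.1 h) j)
  have hmon : ∀ e : Fin M →₀ ℕ, ∃ G, dirD v G = monomial e 1 :=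
    fun e => exists_dirD_eq_monomial v j hj _ e rfl
  choose G hG using hmon
  refine ⟨∑ e ∈ P.support, coeff e P • G e, ?_⟩
  rw [map_sum]
  conv_rhs => rw [as_sum P]
  refine Finset.sum_congr rfl fun e _ => ?_
  rw [map_smul, hG, smul_monomial, smul_eq_mul, mul_one]

/-! ## §1 The transversal Stokes descent on the unit cube

For `T = P/Q` on `[0,1]^{M+1}` and a direction `v ≠ 0` with `D_v Q = 0`, a `D_v`-primitive `G` of `P`
gives `P/Q = D_v (G/Q) = Σ_k ∂_k (v_k G / Q)`, and each `∂_k`-term is one Stokes move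
(`RFun.stokesAt`): `[T] ≡ Σ_k ([v_k G/Q |_{x_k=1}] − [v_k G/Q |_{x_k=0}])`, all on `[0,1]^M`. -/

/-- The potential `a · G / Q` with the denominator of `T`. [folklore] -/
def W (T : RFun M) (G : MvPolynomial (Fin M) ℚ) (a : ℚ) : RFun M := ⟨C a * G, T.den, T.den_ne⟩

/-- Auxiliary step `zero_le_one_and` (§1): zero le one and. [bookkeeping] -/
theorem zero_le_one_and : (0 : ℚ) ≤ 1 ∧ (1 : ℚ) ≤ 1 := ⟨zero_le_one, le_rfl⟩
/-- Auxiliary step `le_rfl_and` (§1): le rfl and. [bookkeeping] -/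
theorem le_rfl_and : (0 : ℚ) ≤ 0 ∧ (0 : ℚ) ≤ 1 := ⟨le_rfl, zero_le_one⟩

/-- The upper face term `[a G/Q |_{x_k = 1}]`. [folklore] -/
def faceHi (T : RFun (M + 1)) (G : MvPolynomial (Fin (M + 1)) ℚ) (a : ℚ) (k : Fin (M + 1)) : RFun M :=
  (W T G a).faceAt k 1 zero_le_one_and

/-- The lower face term `[a G/Q |_{x_k = 0}]`. [folklore] -/
def faceLo (T : RFun (M + 1)) (G : MvPolynomial (Fin (M + 1)) ℚ) (a : ℚ) (k : Fin (M + 1)) : RFun M :=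
  (W T G a).faceAt k 0 le_rfl_and

/-- Pointwise: `P/Q = Σ_k ∂_k (v_k G/Q)` on the cube when `D_v G = P`, `D_v Q = 0`. [folklore] -/
theorem fn_eq_sum_pd (T : RFun M) (v : Fin M → ℚ) (G : MvPolynomial (Fin M) ℚ)
    (hG : dirD v G = T.num) (hQ : dirD v T.den = 0) (x : Fin M → ℝ) (hx : x ∈ KZ.cube M) :
    T.fn x = ∑ k, ((W T G (v k)).pd k).fn x := by
  have hden : aeval x T.den ≠ 0 := T.den_ne x hx
  have hnum : ∀ k, ((W T G (v k)).pd k).fn x =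
      ((v k : ℝ) * aeval x (pderiv k G) * aeval x T.den -
        (v k : ℝ) * aeval x G * aeval x (pderiv k T.den)) / (aeval x T.den) ^ 2 := by
    intro k
    show aeval x (pderiv k (C (v k) * G) * T.den - C (v k) * G * pderiv k T.den) /
        aeval x (T.den ^ 2) = _
    rw [(pderiv k).leibniz, pderiv_C, smul_zero, add_zero, smul_eq_mul]
    simp only [map_sub, map_mul, map_pow, MvPolynomial.aeval_C, eq_ratCast]
  rw [Finset.sum_congr rfl fun k _ => hnum k, ← Finset.sum_div]
  have h1 : ∑ k, ((v k : ℝ) * aeval x (pderiv k G) * aeval x T.den -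
      (v k : ℝ) * aeval x G * aeval x (pderiv k T.den)) =
      aeval x T.den * aeval x (dirD v G) - aeval x G * aeval x (dirD v T.den) := by
    rw [aeval_dirD, aeval_dirD, Finset.mul_sum, Finset.mul_sum, ← Finset.sum_sub_distrib]
    refine Finset.sum_congr rfl fun k _ => ?_
    ring
  rw [h1, hG, hQ, map_zero, mul_zero, sub_zero, RFun.fn]
  field_simp

/-- **The descent relation**: `[P/Q] − Σ_k ([v_k G/Q|_{x_k=1}] − [v_k G/Q|_{x_k=0}]) ∈ relations`
for a `D_v`-primitive `G` of `P` (`v ≠ 0`, `D_v Q = 0`). [cite: KontsevichZagier2001, §1.2 rule (3)] -/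
theorem descent_rel (T : RFun (M + 1)) (v : Fin (M + 1) → ℚ) (hv : v ≠ 0) (hQ : dirD v T.den = 0) :
    ∃ G : MvPolynomial (Fin (M + 1)) ℚ, dirD v G = T.num ∧
      KZ.of T.rep - ∑ k, (KZ.of (faceHi T G (v k) k).rep - KZ.of (faceLo T G (v k) k).rep) ∈
        KZ.relations := by
  obtain ⟨G, hG⟩ := exists_dirD_eq v hv T.num
  refine ⟨G, hG, ?_⟩
  have h1 : KZ.of T.rep - ∑ k, KZ.of ((W T G (v k)).pd k).rep ∈ KZ.relations :=
    RFun.rel_sum Finset.univ (fun k => (W T G (v k)).pd k) T (fun x hx => fn_eq_sum_pd T v G hG hQ x hx)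
  have h2 : ∑ k, (KZ.of ((W T G (v k)).pd k).rep -
      (KZ.of (faceHi T G (v k) k).rep - KZ.of (faceLo T G (v k) k).rep)) ∈ KZ.relations :=
    sum_mem fun k _ => RFun.stokesAt k (W T G (v k))
  have heq : KZ.of T.rep - ∑ k, (KZ.of (faceHi T G (v k) k).rep - KZ.of (faceLo T G (v k) k).rep) =
      (KZ.of T.rep - ∑ k, KZ.of ((W T G (v k)).pd k).rep) +
      ∑ k, (KZ.of ((W T G (v k)).pd k).rep -
        (KZ.of (faceHi T G (v k) k).rep - KZ.of (faceLo T G (v k) k).rep)) := by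
    simp only [Finset.sum_sub_distrib]; abel
  rw [heq]
  exact KZ.relations.add_mem h1 h2

/-! ## §2 Formal sums of cube representations of one dimension -/

/-- Sum of a list of regular rational functions (common denominator = product). [folklore] -/
def lsum : List (RFun M) → RFun M
  | [] => RFun.const 0
  | T :: l => T.add (lsum l)

/-- Auxiliary step `fn_lsum` (§2): fn lsum. [bookkeeping] -/
theorem fn_lsum : ∀ (l : List (RFun M)) (x : Fin M → ℝ), x ∈ KZ.cube M →
    (lsum l).fn x = (l.map fun T => T.fn x).sum
  | [], x, _ => by simp [lsum]
  | T :: l, x, hx => by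
    rw [lsum, RFun.fn_add hx, fn_lsum l x hx, List.map_cons, List.sum_cons]

/-- `[Σ l] − Σ_{T ∈ l} [T] ∈ relations`. [cite: KontsevichZagier2001, §1.2 rule (1)] -/
theorem rel_lsum : ∀ l : List (RFun M),
    KZ.of (lsum l).rep - (l.map fun T => KZ.of T.rep).sum ∈ KZ.relations
  | [] => by
    simpa [lsum] using RFun.rel_of_eqOn_zero (T := (RFun.const 0 : RFun M)) (fun x _ => by simp)
  | T :: l => by
    have h1 := RFun.rel_add T (lsum l)
    have h2 := rel_lsum l
    have heq : KZ.of (lsum (T :: l)).rep - ((T :: l).map fun T => KZ.of T.rep).sum =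
        (KZ.of (T.add (lsum l)).rep - KZ.of T.rep - KZ.of (lsum l).rep) +
        (KZ.of (lsum l).rep - (l.map fun T => KZ.of T.rep).sum) := by
      rw [List.map_cons, List.sum_cons, lsum]; abel
    rw [heq]
    exact KZ.relations.add_mem h1 h2

/-- Soundness: congruent formal combinations have equal values. [cite: KontsevichZagier2001, §1.2] -/
private theorem eval_eq_of_sub_mem {x y : FormalRep} (h : x - y ∈ relations) : eval x = eval y := by
  have h' := relations_le_ker_eval_holds h
  rw [AddMonoidHom.mem_ker, map_sub] at h'
  exact sub_eq_zero.1 h'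

/-- A representation congruent to zero has value zero. [cite: KontsevichZagier2001, §1.2] -/
theorem value_eq_zero_of_mem {n : ℕ} {r : IntegralRep n} (h : of r ∈ relations) : r.value = 0 := by
  have h' := relations_le_ker_eval_holds h
  rwa [AddMonoidHom.mem_ker, eval_of] at h'

/-- The value of the zero constant on a cube is `0` (by soundness, no integration). [folklore] -/
theorem value_const_zero : (RFun.const 0 : RFun M).rep.value = 0 :=
  value_eq_zero_of_mem (RFun.rel_of_eqOn_zero (T := (RFun.const 0 : RFun M)) fun x _ => by simp)

/-- A cube representation of a regular rational function has KZ's rational shape. [folklore] -/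
theorem isRational_rep (T : RFun M) : T.rep.IsRational :=
  ⟨T.num, T.den, fun x hx => T.den_ne x hx, fun _ _ => rfl⟩

/-- **The bottom of the ladder (Baker, in the tree)**: a cube representation of dimension `≤ 1`
with value `0` is `≡ 0`, by `LowDimension.LowdimBaker0DimLeOne` (= `KZ_≤1` for the rational shape,
proved from Baker's theorem). [cite: KontsevichZagier2001, §1.2] -/
theorem rep_mem_relations_of_dim_le_one (hM : M ≤ 1) (T : RFun M) (h0 : T.rep.value = 0) :
    KZ.of T.rep ∈ KZ.relations := by
  have hZ := RFun.rel_of_eqOn_zero (T := (RFun.const 0 : RFun M)) fun x _ => by simp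
  have hE : KZ.Equivalent T.rep (RFun.const 0 : RFun M).rep :=
    Summit.KontsevichZagierPeriods.LowDimension.LowdimBaker0DimLeOne.lowdimBaker0DimLeOne_proof hM hM
      T.rep (RFun.const 0 : RFun M).rep (isRational_rep T) (isRational_rep _)
      (by rw [h0, value_const_zero])
  have : KZ.of T.rep = (KZ.of T.rep - KZ.of (RFun.const 0 : RFun M).rep) +
      KZ.of (RFun.const 0 : RFun M).rep := by abel
  rw [this]
  exact KZ.relations.add_mem hE hZ

/-- Any rational-shape representation of dimension `≤ 1` with value `0` is `≡ 0`. [cite: KontsevichZagier2001, §1.2] -/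
private theorem mem_relations_of_dim_le_one {n : ℕ} (hn : n ≤ 1) (q : IntegralRep n) (hq : q.IsRational)
    (h0 : q.value = 0) : of q ∈ relations := by
  have hZ := RFun.rel_of_eqOn_zero (T := (RFun.const 0 : RFun n)) fun x _ => by simp
  have hE : KZ.Equivalent q (RFun.const 0 : RFun n).rep :=
    Summit.KontsevichZagierPeriods.LowDimension.LowdimBaker0DimLeOne.lowdimBaker0DimLeOne_proof hn hn
      q (RFun.const 0 : RFun n).rep hq (isRational_rep _) (by rw [h0, value_const_zero])
  have : of q = (of q - of (RFun.const 0 : RFun n).rep) + of (RFun.const 0 : RFun n).rep := by abel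
  rw [this]
  exact KZ.relations.add_mem hE hZ

/-- Left multiplication by `[π]`, iterated, is additive. [folklore] -/
theorem iterate_piMul_add (N : ℕ) (x y : FormalRep) :
    (fun z : FormalRep => of piRep * z)^[N] (x + y) =
      (fun z : FormalRep => of piRep * z)^[N] x + (fun z : FormalRep => of piRep * z)^[N] y := by
  induction N with
  | zero => rfl
  | succ N ih => simp only [Function.iterate_succ_apply', ih, mul_add]

/-! ## §3 Rank ≤ 1 denominators: `Q = Q₁(ℓ)` descends to dimension one -/

/-- The affine form `c₀ + Σ_i c_i x_i` with rational coefficients. [folklore] -/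
def affForm (c₀ : ℚ) (c : Fin M → ℚ) : MvPolynomial (Fin M) ℚ := C c₀ + ∑ i, C (c i) * X i

/-- `Q` has rank `≤ 1`: `Q = Q₁(ℓ)` for a univariate `Q₁ ∈ ℚ[t]` and an affine form `ℓ`. [folklore] -/
def RankLeOneDen (Q : MvPolynomial (Fin M) ℚ) : Prop :=
  ∃ (Q₁ : Polynomial ℚ) (c₀ : ℚ) (c : Fin M → ℚ), Q = Polynomial.aeval (affForm c₀ c) Q₁

/-- Auxiliary step `dirD_affForm` (§3): dir D aff Form. [bookkeeping] -/
theorem dirD_affForm (v : Fin M → ℚ) (c₀ : ℚ) (c : Fin M → ℚ) :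
    dirD v (affForm c₀ c) = C (∑ i, c i * v i) := by
  simp only [affForm, map_add, map_sum, dirD_C, dirD_mul, dirD_X, zero_mul, zero_add, ← map_mul]

/-- `D_v (Q₁(ℓ)) = 0` when `v` is in the kernel of the linear part of `ℓ`. [folklore] -/
theorem dirD_eq_zero_of_rankLeOne {v : Fin M → ℚ} {Q₁ : Polynomial ℚ} {c₀ : ℚ} {c : Fin M → ℚ}
    (hv : ∑ i, c i * v i = 0) : dirD v (Polynomial.aeval (affForm c₀ c) Q₁) = 0 := by
  rw [dirD_polynomial_aeval, dirD_affForm, hv, C_0, mul_zero]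

/-- In dimension `≥ 2` a rank `≤ 1` denominator has a rational kernel direction. [folklore] -/
theorem exists_dir_of_rankLeOne {n : ℕ} (Q : MvPolynomial (Fin (n + 1 + 1)) ℚ) (hQ : RankLeOneDen Q) :
    ∃ v : Fin (n + 1 + 1) → ℚ, v ≠ 0 ∧ dirD v Q = 0 := by
  obtain ⟨Q₁, c₀, c, rfl⟩ := hQ
  by_cases h0 : c 0 = 0
  · refine ⟨Fin.cons 1 0, fun h => ?_, dirD_eq_zero_of_rankLeOne ?_⟩
    · have := congr_fun h 0
      simp at this
    · rw [Fin.sum_univ_succ]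
      simp [h0]
  · refine ⟨Fin.cons (c 1) (Fin.cons (-c 0) 0), fun h => ?_, dirD_eq_zero_of_rankLeOne ?_⟩
    · have := congr_fun h (Fin.succ 0)
      simp only [Fin.cons_succ, Fin.cons_zero, Pi.zero_apply, neg_eq_zero] at this
      exact h0 this
    · rw [Fin.sum_univ_succ, Fin.sum_univ_succ]
      simp only [Fin.cons_zero, Fin.cons_succ, Pi.zero_apply, mul_zero, Finset.sum_const_zero,
        add_zero]
      simp only [Fin.succ_zero_eq_one]
      ring

/-- Restricting to a face keeps rank `≤ 1`: `Q₁(ℓ)|_{x_k = b} = Q₁(ℓ|_{x_k=b})`. [folklore] -/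
theorem rankLeOneDen_faceAt {T : RFun (M + 1)} (hT : RankLeOneDen T.den)
    (G : MvPolynomial (Fin (M + 1)) ℚ) (a : ℚ) (k : Fin (M + 1)) (b : ℚ) (hb : 0 ≤ b ∧ b ≤ 1) :
    RankLeOneDen ((W T G a).faceAt k b hb).den := by
  obtain ⟨Q₁, c₀, c, hQ⟩ := hT
  refine ⟨Q₁, c₀ + c k * b, fun i => c (k.succAbove i), ?_⟩
  show bind₁ (RFun.faceSubst M b) (MvPolynomial.rename (RFun.toLast k) (W T G a).den) = _
  have hW : (W T G a).den = T.den := rfl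
  have hℓ : bind₁ (RFun.faceSubst M b) (MvPolynomial.rename (RFun.toLast k) (affForm c₀ c)) =
      affForm (c₀ + c k * b) (fun i => c (k.succAbove i)) := by
    simp only [affForm, map_add, map_sum, map_mul, MvPolynomial.rename_C, MvPolynomial.rename_X,
      MvPolynomial.bind₁_C_right, MvPolynomial.bind₁_X_right]
    rw [Fin.sum_univ_succAbove _ k, RFun.toLast_self]
    simp only [RFun.toLast_succAbove, RFun.faceSubst, Fin.lastCases_last, Fin.lastCases_castSucc]
    ring
  rw [hW, hQ, ← Polynomial.aeval_algHom_apply, ← Polynomial.aeval_algHom_apply, hℓ]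

end Summit.KontsevichZagierPeriods.RootDecompRationalCubeDichotomy.Rung26322.RankDescent
end
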